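import Mathlib
import Summits.MatrixMultiplication.MatrixMultiplication.Theses.FourierTwoFamiliesModP

/-!
# Sketch — crux-ideate round 2, ideator 6, crux `PrimeTwoFamilies` (stmt-MatrixMultiplication-14308)

Idea card `zero-error-capacity-gadgets`: SDPP families as ZERO-ERROR CODES over a REDUNDANT
alphabet of direct pairs.  A "gadget" is any finite list of direct pairs `(P σ, Q σ)_{σ<r}` in an
abelian group `K` (letters may overlap, may be translates of each other, need not be pairwise
separated).  Put `D := ⋃_c (Q c − P c)`.  Letter `σ` is STRONGLY SEPARATED towards `τ`
(`StrongSep P Q σ τ`) if the cross difference set `Q τ − P σ` avoids `D`.  A set of words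
`W ⊆ (Fin L → Fin r)` in which every ORDERED pair of distinct words is strongly separated in some
coordinate (`IsZeroErrorCode`) lifts to an SDPP family in `Fin L → K` (`codeLift`, PROVED below):
this is the Sperner-capacity / Shannon zero-error-capacity framework, and its rate can strictly
exceed `log` of the largest honest (pairwise separated) or ladder (transitive) sub-alphabet —
the amplification that products of honest designs provably lack (Lines/ladder-zone-frame-cap.md §A).
The L = 2 mechanism (`selfConverseLift`, PROVED): if a map `π` on letters separates every ordered
pair either directly or after `π` (a self-converse / self-complementary separation pattern, as for
Paley graphs and Paley tournaments), the `r` graph-words `(σ, π σ)` are an SDPP family of `r` blocks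
in `K × K` — Lovász's `Θ = √r` code.  Certified toy instance (`pentagon_design`, kernel `decide`):
the 5 letters `({u}, {u, u+1})` of `ℤ/5` have confusability graph `C₅`; the Shannon code
`{(u, 2u)}` gives 5 SDPP blocks in `ℤ/5 × ℤ/5`, while at most 2 of the 5 letters are pairwise
separated (so honest products give only 4 blocks in `(ℤ/5)²`).
Transfer targets: `CapacityGadgets` (general code form) and `SelfConverseGadgets` (L = 2 form);
`primeTwoFamilies_of_capacityGadgets` is the (M-sized, sorried) bookkeeping via the tree's
`Theorems.exists_prime_sdpp_of_addEquiv`.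
-/

-- single-conjunct summit: the mandated namespace repeats `MatrixMultiplication`.
set_option linter.dupNamespace false

namespace Summit.MatrixMultiplication.MatrixMultiplication.Cruxes.PrimeTwoFamilies.IdeatorSix

open Finset
open Summit.MatrixMultiplication.MatrixMultiplication.Theses

/-! ## Objects -/

/-- Every letter `(P c, Q c)` is a DIRECT pair (clause (W) letterwise). -/
def Direct {K : Type*} [AddCommGroup K] {r : ℕ} (P Q : Fin r → Finset K) : Prop :=
  ∀ c : Fin r, ∀ x ∈ P c, ∀ x' ∈ P c, ∀ y ∈ Q c, ∀ y' ∈ Q c,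
    (x - x') + (y - y') = 0 → x = x' ∧ y = y'

/-- STRONG SEPARATION of letter `σ` towards letter `τ`: the cross difference set `Q τ − P σ`
avoids every diagonal difference set `Q c − P c` (for all letters `c`, i.e. it avoids
`D = ⋃_c (Q c − P c)`).  An honest SDPP family is a gadget in which all ordered pairs of distinct
letters are strongly separated; a ladder is one in which `σ < τ` are. -/
def StrongSep {K : Type*} [AddCommGroup K] {r : ℕ} (P Q : Fin r → Finset K) (σ τ : Fin r) : Prop :=
  ∀ p ∈ P σ, ∀ q ∈ Q τ, ∀ c : Fin r, ∀ p' ∈ P c, ∀ q' ∈ Q c, q - p ≠ q' - p'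

/-- A ZERO-ERROR CODE over the gadget: every ordered pair of distinct words is strongly separated
in at least one coordinate.  (Its maximal rate is the Sperner capacity of the strong-separation
digraph — Gargano–Körner–Vaccaro; for a symmetric digraph, `log` of the Shannon capacity of the
confusability graph.) -/
def IsZeroErrorCode {K : Type*} [AddCommGroup K] {r L : ℕ} (P Q : Fin r → Finset K)
    (W : Finset (Fin L → Fin r)) : Prop :=
  ∀ i ∈ W, ∀ k ∈ W, i ≠ k → ∃ t : Fin L, StrongSep P Q (i t) (k t)

/-! ## First lemma: the code lift (PROVED) -/

/-- **CODE LIFT.**  A zero-error code over a gadget of direct pairs lifts to an SDPP family in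
`Fin L → K`: blocks `A w = ∏ₜ P (w t)`, `B w = ∏ₜ Q (w t)` for `w ∈ W`, clauses (W),(X) verbatim as
in the route.  (Generalises `tensorLemma_holds` / `stub_lift` of round 1, whose codes are the
antichains / constant-sum words of a TRANSITIVE separation pattern.) -/
theorem codeLift {K : Type*} [AddCommGroup K] [DecidableEq K] {r L : ℕ}
    (P Q : Fin r → Finset K) (hD : Direct P Q)
    (W : Finset (Fin L → Fin r)) (hW : IsZeroErrorCode P Q W) :
    (∀ w ∈ W, ∀ a ∈ Fintype.piFinset (fun t => P (w t)), ∀ a' ∈ Fintype.piFinset (fun t => P (w t)),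
      ∀ b ∈ Fintype.piFinset (fun t => Q (w t)), ∀ b' ∈ Fintype.piFinset (fun t => Q (w t)),
        (a - a') + (b - b') = 0 → a = a' ∧ b = b') ∧
    (∀ i ∈ W, ∀ j ∈ W, ∀ k ∈ W,
      ∀ a ∈ Fintype.piFinset (fun t => P (i t)), ∀ a' ∈ Fintype.piFinset (fun t => P (j t)),
      ∀ b ∈ Fintype.piFinset (fun t => Q (j t)), ∀ b' ∈ Fintype.piFinset (fun t => Q (k t)),
        (a - a') + (b - b') = 0 → i = k) := by
  refine ⟨?_, ?_⟩
  · intro w _ a ha a' ha' b hb b' hb' h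
    rw [Fintype.mem_piFinset] at ha ha' hb hb'
    have key : ∀ t, a t = a' t ∧ b t = b' t := fun t =>
      hD (w t) (a t) (ha t) (a' t) (ha' t) (b t) (hb t) (b' t) (hb' t)
        (by have := congrFun h t; simpa using this)
    exact ⟨funext fun t => (key t).1, funext fun t => (key t).2⟩
  · intro i hi j _ k hk a ha a' ha' b hb b' hb' h
    rw [Fintype.mem_piFinset] at ha ha' hb hb'
    by_contra hik
    obtain ⟨t, ht⟩ := hW i hi k hk hik
    have key : (a t - a' t) + (b t - b' t) = 0 := by
      have := congrFun h t; simpa using this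
    have e : b' t - a t = b t - a' t := by
      have h2 : (a t - a' t) + (b t - b' t) = (b t - a' t) - (b' t - a t) := by abel
      rw [h2] at key
      exact (sub_eq_zero.1 key).symm
    exact ht (a t) (ha t) (b' t) (hb' t) (j t) (a' t) (ha' t) (b t) (hb t) e

/-! ## The L = 2 mechanism: self-converse separation patterns (PROVED) -/

/-- **SELF-CONVERSE LIFT** (Lovász's `Θ(G) = √|G|` code for self-complementary vertex-transitive
graphs / the anti-automorphism code for self-converse tournaments, in gadget form).  If `π` maps the
letters so that every ordered pair of distinct letters is strongly separated either directly or
after `π`, then the `r` graph-words `(σ, π σ)` give an SDPP family of `r` blocks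
`(P σ × P (π σ), Q σ × Q (π σ))` in `K × K`.  With `r = m^{1-ε}` letters of co-volume `m^{1-ε}` in
`K = ℤ/m` this is the APEX (`n = N^{(1-ε)/2}` blocks of co-volume `N^{1-ε}`, `N = m²`). -/
theorem selfConverseLift {K : Type*} [AddCommGroup K] [DecidableEq K] {r : ℕ}
    (P Q : Fin r → Finset K) (hD : Direct P Q) (π : Fin r → Fin r)
    (hπ : ∀ σ τ : Fin r, σ ≠ τ → StrongSep P Q σ τ ∨ StrongSep P Q (π σ) (π τ)) :
    (∀ σ : Fin r, ∀ a ∈ P σ ×ˢ P (π σ), ∀ a' ∈ P σ ×ˢ P (π σ),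
      ∀ b ∈ Q σ ×ˢ Q (π σ), ∀ b' ∈ Q σ ×ˢ Q (π σ),
        (a - a') + (b - b') = 0 → a = a' ∧ b = b') ∧
    (∀ i j k : Fin r, ∀ a ∈ P i ×ˢ P (π i), ∀ a' ∈ P j ×ˢ P (π j),
      ∀ b ∈ Q j ×ˢ Q (π j), ∀ b' ∈ Q k ×ˢ Q (π k),
        (a - a') + (b - b') = 0 → i = k) := by
  refine ⟨?_, ?_⟩
  · intro σ a ha a' ha' b hb b' hb' h
    rw [Finset.mem_product] at ha ha' hb hb'
    have h1 : (a.1 - a'.1) + (b.1 - b'.1) = 0 := by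
      have := congrArg Prod.fst h; simpa using this
    have h2 : (a.2 - a'.2) + (b.2 - b'.2) = 0 := by
      have := congrArg Prod.snd h; simpa using this
    obtain ⟨e1, f1⟩ := hD σ a.1 ha.1 a'.1 ha'.1 b.1 hb.1 b'.1 hb'.1 h1
    obtain ⟨e2, f2⟩ := hD (π σ) a.2 ha.2 a'.2 ha'.2 b.2 hb.2 b'.2 hb'.2 h2
    exact ⟨Prod.ext e1 e2, Prod.ext f1 f2⟩
  · intro i j k a ha a' ha' b hb b' hb' h
    rw [Finset.mem_product] at ha ha' hb hb'
    by_contra hik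
    have h1 : (a.1 - a'.1) + (b.1 - b'.1) = 0 := by
      have := congrArg Prod.fst h; simpa using this
    have h2 : (a.2 - a'.2) + (b.2 - b'.2) = 0 := by
      have := congrArg Prod.snd h; simpa using this
    rcases hπ i k hik with hs | hs
    · have e : b'.1 - a.1 = b.1 - a'.1 := by
        have h3 : (a.1 - a'.1) + (b.1 - b'.1) = (b.1 - a'.1) - (b'.1 - a.1) := by abel
        rw [h3] at h1
        exact (sub_eq_zero.1 h1).symm
      exact hs a.1 ha.1 b'.1 hb'.1 j a'.1 ha'.1 b.1 hb.1 e
    · have e : b'.2 - a.2 = b.2 - a'.2 := by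
        have h3 : (a.2 - a'.2) + (b.2 - b'.2) = (b.2 - a'.2) - (b'.2 - a.2) := by abel
        rw [h3] at h2
        exact (sub_eq_zero.1 h2).symm
      exact hs a.2 ha.2 b'.2 hb'.2 (π j) a'.2 ha'.2 b.2 hb.2 e

/-! ## Certified toy instance: the pentagon gadget of `ℤ/5` (amplification exists) -/

/-- The 5 letters `({u}, {u, u+1})`, `u ∈ ℤ/5`. -/
def pentP : Fin 5 → Finset (ZMod 5) := fun i => {((i : ℕ) : ZMod 5)}

/-- (see `pentP`) -/
def pentQ : Fin 5 → Finset (ZMod 5) := fun i => {((i : ℕ) : ZMod 5), ((i : ℕ) : ZMod 5) + 1}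

/-- The Shannon code of the pentagon: `u ↦ 2u`. -/
def pentPi : Fin 5 → Fin 5 := fun i => ⟨(2 * (i : ℕ)) % 5, Nat.mod_lt _ (by norm_num)⟩

set_option maxRecDepth 200000 in
set_option synthInstance.maxHeartbeats 800000 in
set_option synthInstance.maxSize 2048 in
/-- **PENTAGON GADGET** (kernel-checked by `decide`): the letters are direct; strong separation
`u ⇝ v` holds iff `v - u ∈ {2, 3}` (so the confusability graph is the pentagon `C₅`: consecutive
letters are separated in NEITHER direction, and at most 2 of the 5 letters are pairwise separated);
and the map `u ↦ 2u` separates every ordered pair either directly or after the map. -/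
theorem pentagon_gadget :
    Direct pentP pentQ ∧
    (∀ σ : Fin 5, ¬ StrongSep pentP pentQ σ (σ + 1) ∧ ¬ StrongSep pentP pentQ (σ + 1) σ) ∧
    (∀ σ τ : Fin 5, σ ≠ τ →
      StrongSep pentP pentQ σ τ ∨ StrongSep pentP pentQ (pentPi σ) (pentPi τ)) := by
  unfold Direct StrongSep pentP pentQ pentPi
  simp only [Finset.mem_insert, Finset.mem_singleton, forall_eq_or_imp, forall_eq]
  decide

/-- **PENTAGON DESIGN**: hence (by `selfConverseLift`) the 5 blocks
`({u} × {2u}, {u,u+1} × {2u,2u+1})` form an SDPP family in `ℤ/5 × ℤ/5` — 5 blocks, where honest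
products of pairwise-separated letters give at most `2² = 4` (`Θ(C₅)² = 5 > α(C₅)² = 4`). -/
theorem pentagon_design :
    (∀ σ : Fin 5, ∀ a ∈ pentP σ ×ˢ pentP (pentPi σ), ∀ a' ∈ pentP σ ×ˢ pentP (pentPi σ),
      ∀ b ∈ pentQ σ ×ˢ pentQ (pentPi σ), ∀ b' ∈ pentQ σ ×ˢ pentQ (pentPi σ),
        (a - a') + (b - b') = 0 → a = a' ∧ b = b') ∧
    (∀ i j k : Fin 5, ∀ a ∈ pentP i ×ˢ pentP (pentPi i), ∀ a' ∈ pentP j ×ˢ pentP (pentPi j),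
      ∀ b ∈ pentQ j ×ˢ pentQ (pentPi j), ∀ b' ∈ pentQ k ×ˢ pentQ (pentPi k),
        (a - a') + (b - b') = 0 → i = k) :=
  selfConverseLift pentP pentQ pentagon_gadget.1 pentPi pentagon_gadget.2.2

/-! ## Transfer targets (OPEN) and the bookkeeping transfer (provable now, sorried here) -/

/-- **CAPACITY GADGETS** (transfer target C⁺, general code form): for every `ε > 0` there are
arbitrarily large `m`, a gadget of direct pairs in `ℤ/m` with all co-volumes `≥ m^{1-ε}`, and a
zero-error code `W` of length `L ≥ 1` over it with `|W| ≥ (m^L)^{1/2-ε}` — i.e. Sperner capacity of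
the strong-separation digraph `≥ (1/2 - ε)·log m` at co-volume exponent `1 - ε`.  An honest SDPP
witness of the crux is the case `L = 1`, `W = all letters`; the point of C⁺ is that `W` may be a
capacity-achieving code over letters that are NOT pairwise separated. -/
def CapacityGadgets : Prop :=
  ∀ ε : ℝ, 0 < ε → ∀ m₀ : ℕ, ∃ m ≥ m₀, ∃ r L : ℕ, ∃ P Q : Fin r → Finset (ZMod m),
    ∃ W : Finset (Fin L → Fin r),
      Direct P Q ∧ IsZeroErrorCode P Q W ∧ 1 ≤ L ∧
      ((m : ℝ) ^ (L : ℝ)) ^ (1 / 2 - ε) ≤ (W.card : ℝ) ∧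
      ∀ c : Fin r, (m : ℝ) ^ (1 - ε) ≤ (((P c).card * (Q c).card : ℕ) : ℝ)

/-- **SELF-CONVERSE GADGETS** (transfer target, L = 2 form — the form in which the apex is a
statement about ONE separation PATTERN): arbitrarily large `m`, `r ≥ m^{1-ε}` direct pairs in `ℤ/m`
of co-volume `≥ m^{1-ε}` (necessarily heavily overlapping: `r·covol ≫ m`), and a map `π` under
which every ordered pair of distinct letters is strongly separated directly or after `π`. -/
def SelfConverseGadgets : Prop :=
  ∀ ε : ℝ, 0 < ε → ∀ m₀ : ℕ, ∃ m ≥ m₀, ∃ r : ℕ, ∃ P Q : Fin r → Finset (ZMod m), ∃ π : Fin r → Fin r,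
    Direct P Q ∧ (∀ σ τ : Fin r, σ ≠ τ → StrongSep P Q σ τ ∨ StrongSep P Q (π σ) (π τ)) ∧
    (m : ℝ) ^ (1 - ε) ≤ (r : ℝ) ∧
    ∀ c : Fin r, (m : ℝ) ^ (1 - ε) ≤ (((P c).card * (Q c).card : ℕ) : ℝ)

/-- L = 2 is a code: the self-converse form implies the general capacity form (words `(σ, π σ)`;
size S — `selfConverseLift` restated over `Fin 2 → ℤ/m`). -/
theorem capacityGadgets_of_selfConverse (h : SelfConverseGadgets) : CapacityGadgets := by
  sorry

/-- **TRANSFER** (size M, provable now): capacity gadgets give every slice of the crux.  Proof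
route: `codeLift` gives `|W|` SDPP blocks in `Fin L → ℤ/m` with co-volume `≥ m^{(1-ε)L}`; the
tree's `Theorems.exists_prime_sdpp_of_addEquiv` (mixed-radix Freiman map + Bertrand, `k = L`
cyclic factors) moves them into a prime `p ≤ 2·3^L·m^L` with sizes kept; with `ε ≤ δ/8` and
`m ≥ 3^{8/δ}` the exponents close (`p ≤ n^{2+δ}`, co-volume `≥ n^{2-δ}`, `n = |W| → ∞`). -/
theorem primeTwoFamilies_of_capacityGadgets (h : CapacityGadgets) :
    FourierTwoFamiliesModP.PrimeTwoFamilies := by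
  sorry

end Summit.MatrixMultiplication.MatrixMultiplication.Cruxes.PrimeTwoFamilies.IdeatorSix
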